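import Summits.AtomisticToContinuum.Crystallization.Theorems.ChessboardParticlePlanesPeriodicWindowsOfGoodWindows

/-!
# Local frames, structure side A: restriction to bond-closed subsets and the covering radius of Barlow stackings

Crux `StackingFaultSparsity` (stmt-AtomisticToContinuum-14296), line `Sketch`, reshape 11, the lead's glue — part 2A.

* `locframe_restrict` — an exact local frame of `p` in `X` (the predicate of the geometric stubs, spelled out) is an
  exact local frame of `p` in any bond-closed subset `K ∋ p` of `X` (`K ⊆ X` and `q ∈ K, r ∈ X, dist q r ≤ 1 ⇒ r ∈ K`):
  every point the frame names is within distance `1` of `p` or of a shell point of `p`.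
* `exists_barlowPos_dist_sq_le` — covering radius of a Barlow stacking: every point of `ℝ³` is within
  `√(a²/4 + 3a²/16 + h²/4)` of `barlowStacking a h s` (nearest layer, nearest row, nearest point — read off the
  coordinates `barlowPos_apply_zero/one/two`).
* `subset_of_barlow_of_separated` — if a subset `K` of a `19/20`-separated set `X` is an isometric image of
  `barlowStacking a h s` with `a ≤ 1`, `h ≤ 9/10`, then `X = K` (a point of `X` off `K` would be within `0.84` of `K`).

All `[folklore]`; Mathlib + the landed `BarlowStacking` API only.
-/

noncomputable section

namespace Summit.AtomisticToContinuum.Crystallization.Theorems.SquareWellLayerCake.StackingFaultSparsity.LocalFrames.Structure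

open Literature.MathematicalPhysics.StatisticalMechanics

/-- **Restriction of an exact local frame to a bond-closed subset.** [folklore] -/
theorem locframe_restrict {X K : Set (EuclideanSpace ℝ (Fin 3))} (hKX : K ⊆ X)
    (hcl : ∀ q ∈ K, ∀ r ∈ X, dist q r ≤ 1 → r ∈ K) {p : EuclideanSpace ℝ (Fin 3)} (hp : p ∈ K)
    {a b : ℝ} {n : EuclideanSpace ℝ (Fin 3)} {c : ℤ → ℝ}
    (hF : (19 / 20 ≤ a ∧ a ≤ 1 ∧ 19 / 20 ≤ b ∧ b ≤ 1 ∧ ‖n‖ = 1 ∧ c 0 = 0 ∧ (∀ k : ℤ, c k + 19 / 25 ≤ c (k + 1)) ∧ (∀ q ∈ X, ∀ r ∈ X, q ≠ r → 19 / 20 ≤ dist q r) ∧ (∀ q ∈ X, dist q p < 2 → ∃ k : ℤ, inner ℝ (q - p) n = c k) ∧ (∃ H U D : Finset (EuclideanSpace ℝ (Fin 3)), H.card = 6 ∧ U.card = 3 ∧ D.card = 3 ∧ (∀ q ∈ H, q ∈ X ∧ inner ℝ (q - p) n = 0 ∧ dist p q = a) ∧ (∀ q ∈ U, q ∈ X ∧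 inner ℝ (q - p) n = c 1 ∧ dist p q = b) ∧ (∀ q ∈ D, q ∈ X ∧ inner ℝ (q - p) n = c (-1) ∧ dist p q = b) ∧ (∀ q ∈ X, q ≠ p → dist q p ≤ 1 → q ∈ H ∨ q ∈ U ∨ q ∈ D)) ∧ (∀ q ∈ X, q ≠ p → dist q p ≤ 1 → (∃ H' : Finset (EuclideanSpace ℝ (Fin 3)), H'.card = 6 ∧ ∀ r ∈ H', r ∈ X ∧ r ≠ q ∧ inner ℝ (r - p) n = inner ℝ (q - p) n ∧ dist q r = a) ∧ (∃ U' : Finset (EuclideanSpace ℝ (Fin 3)), U'.card = 3 ∧ ∀ r ∈ U', r ∈ X ∧ (∃ k : ℤ, inner ℝ (q - p) n = c k ∧ inner ℝ (r - p) n = c (k + 1)) ∧ dist q r = b) ∧ (∃ D' : Finset (EuclideanSpace ℝ (Fin 3)), D'.card = 3 ∧ ∀ r ∈ D', r ∈ X ∧ (∃ k : ℤ, inner ℝ (q - p) n = c k ∧ inner ℝ (r - p) n = c (k - 1)) ∧ dist q r = b) ∧ (∀ r ∈ X, r ≠ q → dist q r < 1 → (inner ℝ (r - p) n = inner ℝ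 (q - p) n → dist q r = a) ∧ (inner ℝ (r - p) n ≠ inner ℝ (q - p) n → dist q r = b))))) :
    (19 / 20 ≤ a ∧ a ≤ 1 ∧ 19 / 20 ≤ b ∧ b ≤ 1 ∧ ‖n‖ = 1 ∧ c 0 = 0 ∧ (∀ k : ℤ, c k + 19 / 25 ≤ c (k + 1)) ∧ (∀ q ∈ K, ∀ r ∈ K, q ≠ r → 19 / 20 ≤ dist q r) ∧ (∀ q ∈ K, dist q p < 2 → ∃ k : ℤ, inner ℝ (q - p) n = c k) ∧ (∃ H U D : Finset (EuclideanSpace ℝ (Fin 3)), H.card = 6 ∧ U.card = 3 ∧ D.card = 3 ∧ (∀ q ∈ H, q ∈ K ∧ inner ℝ (q - p) n = 0 ∧ dist p q = a) ∧ (∀ q ∈ U, q ∈ K ∧ inner ℝ (q - p) n = c 1 ∧ dist p q = b) ∧ (∀ q ∈ D, q ∈ K ∧ inner ℝ (q - p) n = c (-1) ∧ dist p q = b) ∧ (∀ q ∈ K, q ≠ p → dist q p ≤ 1 → q ∈ H ∨ q ∈ U ∨ q ∈ D)) ∧ (∀ q ∈ K, q ≠ p → dist q p ≤ 1 → (∃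 H' : Finset (EuclideanSpace ℝ (Fin 3)), H'.card = 6 ∧ ∀ r ∈ H', r ∈ K ∧ r ≠ q ∧ inner ℝ (r - p) n = inner ℝ (q - p) n ∧ dist q r = a) ∧ (∃ U' : Finset (EuclideanSpace ℝ (Fin 3)), U'.card = 3 ∧ ∀ r ∈ U', r ∈ K ∧ (∃ k : ℤ, inner ℝ (q - p) n = c k ∧ inner ℝ (r - p) n = c (k + 1)) ∧ dist q r = b) ∧ (∃ D' : Finset (EuclideanSpace ℝ (Fin 3)), D'.card = 3 ∧ ∀ r ∈ D', r ∈ K ∧ (∃ k : ℤ, inner ℝ (q - p) n = c k ∧ inner ℝ (r - p) n = c (k - 1)) ∧ dist q r = b) ∧ (∀ r ∈ K, r ≠ q → dist q r < 1 → (inner ℝ (r - p) n = inner ℝ (q - p) n → dist q r = a) ∧ (inner ℝ (r - p) n ≠ inner ℝ (q - p) n → dist q r = b)))) := by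
  obtain ⟨ha1, ha2, hb1, hb2, hn, hc0, hgap, hsep, hflat, ⟨H, U, D, hH, hU, hD, hHX, hUX, hDX, hexact⟩, hsh⟩ := hF
  have hdist_le : ∀ q : EuclideanSpace ℝ (Fin 3), dist p q = a ∨ dist p q = b → dist p q ≤ 1 := by
    rintro q (h | h) <;> linarith
  refine ⟨ha1, ha2, hb1, hb2, hn, hc0, hgap, fun q hq r hr hqr => hsep q (hKX hq) r (hKX hr) hqr,
    fun q hq hq2 => hflat q (hKX hq) hq2, ⟨H, U, D, hH, hU, hD, ?_, ?_, ?_, ?_⟩, ?_⟩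
  · intro q hq
    obtain ⟨hqX, h1, h2⟩ := hHX q hq
    exact ⟨hcl p hp q hqX (hdist_le q (Or.inl h2)), h1, h2⟩
  · intro q hq
    obtain ⟨hqX, h1, h2⟩ := hUX q hq
    exact ⟨hcl p hp q hqX (hdist_le q (Or.inr h2)), h1, h2⟩
  · intro q hq
    obtain ⟨hqX, h1, h2⟩ := hDX q hq
    exact ⟨hcl p hp q hqX (hdist_le q (Or.inr h2)), h1, h2⟩
  · intro q hq hqp hq1
    exact hexact q (hKX hq) hqp hq1
  · intro q hq hqp hq1
    obtain ⟨⟨H', hH', hH'X⟩, ⟨U', hU', hU'X⟩, ⟨D', hD', hD'X⟩, hsharp⟩ := hsh q (hKX hq) hqp hq1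
    refine ⟨⟨H', hH', fun r hr => ?_⟩, ⟨U', hU', fun r hr => ?_⟩, ⟨D', hD', fun r hr => ?_⟩,
      fun r hr hrq hqr => hsharp r (hKX hr) hrq hqr⟩
    · obtain ⟨hrX, h1, h2, h3⟩ := hH'X r hr
      exact ⟨hcl q hq r hrX (by rw [h3]; exact ha2), h1, h2, h3⟩
    · obtain ⟨hrX, h1, h2⟩ := hU'X r hr
      exact ⟨hcl q hq r hrX (by rw [h2]; exact hb2), h1, h2⟩
    · obtain ⟨hrX, h1, h2⟩ := hD'X r hr
      exact ⟨hcl q hq r hrX (by rw [h2]; exact hb2), h1, h2⟩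

/-- Rounding: for `0 < L` every real `t` is within `L/2` of an integer multiple of `L`. [folklore] -/
theorem exists_int_abs_sub_mul_le (t : ℝ) {L : ℝ} (hL : 0 < L) : ∃ m : ℤ, |t - m * L| ≤ L / 2 := by
  refine ⟨round (t / L), ?_⟩
  have h := abs_sub_round (t / L)
  have hL' : L ≠ 0 := hL.ne'
  have : t - (round (t / L) : ℝ) * L = (t / L - round (t / L)) * L := by field_simp
  rw [this, abs_mul, abs_of_pos hL]
  nlinarith

/-- **Covering radius of a Barlow stacking**: every point of `ℝ³` is within `√(7a²/16 + h²/4)` of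
`barlowStacking a h s` (`0 < a`, `0 < h`, any `s`). [folklore] -/
theorem exists_barlowPos_dist_sq_le {a h : ℝ} (ha : 0 < a) (hh : 0 < h) (s : ℤ → ℤ) (z : EuclideanSpace ℝ (Fin 3)) :
    ∃ k i j : ℤ, dist z (barlowPos a h s k i j) ^ 2 ≤ 7 * a ^ 2 / 16 + h ^ 2 / 4 := by
  -- nearest layer
  obtain ⟨k, hk⟩ := exists_int_abs_sub_mul_le (z 2) hh
  -- nearest row in that layer: rows are at `x₁ = a√3/2 · (j + L/3)`
  have h3 : (0 : ℝ) < a * √3 / 2 := by positivity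
  obtain ⟨j, hj⟩ := exists_int_abs_sub_mul_le (z 1 - a * √3 / 2 * (haggLabel s k / 3)) h3
  -- nearest point in that row: `x₀ = a · (i + j/2 + L/2)`
  obtain ⟨i, hi⟩ := exists_int_abs_sub_mul_le (z 0 - a * (j / 2 + haggLabel s k / 2)) ha
  refine ⟨k, i, j, ?_⟩
  have hd : dist z (barlowPos a h s k i j) ^ 2 =
      (z 0 - barlowPos a h s k i j 0) ^ 2 + (z 1 - barlowPos a h s k i j 1) ^ 2 +
        (z 2 - barlowPos a h s k i j 2) ^ 2 := by
    rw [EuclideanSpace.dist_eq, Real.sq_sqrt (Finset.sum_nonneg fun _ _ => sq_nonneg _),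
      Fin.sum_univ_three]
    simp only [Real.dist_eq, sq_abs]
  rw [hd, barlowPos_apply_zero, barlowPos_apply_one, barlowPos_apply_two]
  have e0 : z 0 - a * (i + j / 2 + haggLabel s k / 2) = (z 0 - a * (j / 2 + haggLabel s k / 2)) - i * a := by ring
  have e1 : z 1 - a * √3 / 2 * (j + haggLabel s k / 3) =
      (z 1 - a * √3 / 2 * (haggLabel s k / 3)) - j * (a * √3 / 2) := by ring
  rw [e0, e1]
  have hsq3 : (√3 : ℝ) ^ 2 = 3 := Real.sq_sqrt (by norm_num)
  have b0 := (sq_le_sq' (by linarith [(abs_le.1 hi).1]) (abs_le.1 hi).2)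
  have b1 := (sq_le_sq' (by linarith [(abs_le.1 hj).1]) (abs_le.1 hj).2)
  have b2 := (sq_le_sq' (by linarith [(abs_le.1 hk).1]) (abs_le.1 hk).2)
  nlinarith [b0, b1, b2, hsq3, sq_nonneg a, sq_nonneg h]

/-- Covering radius, set form: every point is within `19/20 · (9/10)` … concretely, for `a ≤ 1`, `h ≤ 9/10` every
point of `ℝ³` lies at distance `< 19/20` from the stacking. [folklore] -/
theorem exists_mem_barlowStacking_dist_lt {a h : ℝ} (ha : 0 < a) (ha1 : a ≤ 1) (hh : 0 < h) (hh1 : h ≤ 9 / 10)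
    (s : ℤ → ℤ) (z : EuclideanSpace ℝ (Fin 3)) : ∃ p ∈ barlowStacking a h s, dist z p < 19 / 20 := by
  obtain ⟨k, i, j, hkij⟩ := exists_barlowPos_dist_sq_le ha hh s z
  refine ⟨barlowPos a h s k i j, barlowPos_mem k i j, ?_⟩
  have hsq : dist z (barlowPos a h s k i j) ^ 2 < (19 / 20 : ℝ) ^ 2 := by
    have : 7 * a ^ 2 / 16 + h ^ 2 / 4 < (19 / 20 : ℝ) ^ 2 := by nlinarith
    linarith
  exact abs_lt_of_sq_lt_sq' hsq (by norm_num) |>.2 |> fun h' => by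
    simpa using (lt_of_abs_lt (abs_lt.2 ⟨by linarith [dist_nonneg (x := z) (y := barlowPos a h s k i j)], h'⟩))

/-- **A separated superset of a moved Barlow stacking is the stacking.**  If `K ⊆ X`, `X` is `19/20`-separated and
`K = g '' barlowStacking a h s` with `0 < a ≤ 1`, `0 < h ≤ 9/10`, then `X = K`. [folklore] -/
theorem eq_of_barlow_subset :
    ∀ (X K : Set (EuclideanSpace ℝ (Fin 3))), K ⊆ X → (∀ q ∈ X, ∀ r ∈ X, q ≠ r → 19 / 20 ≤ dist q r) → ∀ (a h : ℝ), 0 < a → a ≤ 1 → 0 < h → h ≤ 9 / 10 → ∀ (s : ℤ → ℤ) (g : EuclideanSpace ℝ (Fin 3) ≃ᵢ EuclideanSpace ℝ (Fin 3)), K = g '' Literature.MathematicalPhysics.StatisticalMechanics.barlowStacking a h s → X = K := by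
  intro X K hKX hsep a h ha ha1 hh hh1 s g hK
  refine Set.Subset.antisymm (fun x hx => ?_) hKX
  obtain ⟨p, hp, hpx⟩ := exists_mem_barlowStacking_dist_lt ha ha1 hh hh1 s (g.symm x)
  have hgp : g p ∈ K := by rw [hK]; exact ⟨p, hp, rfl⟩
  by_contra hxK
  have hne : x ≠ g p := fun h => hxK (h ▸ hgp)
  have h1 := hsep x hx (g p) (hKX hgp) hne
  have h2 : dist x (g p) = dist (g.symm x) p := by
    rw [← g.dist_eq (g.symm x) p, IsometryEquiv.apply_symm_apply]
  linarith

end Summit.AtomisticToContinuum.Crystallization.Theorems.SquareWellLayerCake.StackingFaultSparsity.LocalFrames.Structure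

end
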